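import Mathlib.Analysis.Calculus.LineDeriv.IntegrationByParts
import Mathlib.Analysis.InnerProductSpace.Calculus
import Mathlib.Analysis.InnerProductSpace.Trace
import Mathlib.Analysis.Distribution.AEEqOfIntegralContDiff
import Mathlib.MeasureTheory.Measure.OpenPos
import Literature.Analysis.FluidPDE.SphereIntegral
import HarnessLib

/-!
# Integration by parts against radial test functions

Support file (all results proved) for the divergence theorem on spherical shells
(`Literature/Analysis/FluidPDE/ShellDivergence.lean`), itself a step of Bartnik's existence
theorem for the ADM energy (`Literature.Geometry.Lorentzian.AFEnd.HasADMEnergy_of_isAsymptoticallyFlat`).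

* `eqOn_deriv_of_integral_mul_eq` — du Bois-Reymond: if `A ∈ C¹((0, ∞))`, `B ∈ C((0, ∞))` and
  `∫ φ B = -∫ φ' A` for all `φ ∈ C_c^∞((0, ∞))`, then `A' = B` (integration by parts on the line
  and the fundamental lemma of the calculus of variations,
  `IsOpen.ae_eq_zero_of_integral_contDiff_smul_eq_zero`);
* `contDiff_comp_norm_of_tsupport_subset` — `φ ∘ ‖·‖` is `C¹` with
  `D(φ ∘ ‖·‖)(x) = φ'(‖x‖) ‖x‖⁻¹ ⟪x, ·⟫` for `φ` supported in `(0, ∞)`;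
* `integral_radial_mul_divergence` — for `V ∈ C¹(E; E)` on a finite-dimensional inner product
  space with an additive Haar measure: `∫ φ(‖x‖) tr DV(x) = −∫ φ'(‖x‖) ⟪‖x‖⁻¹ x, V x⟫`
  (Mathlib's `integral_mul_fderiv_eq_neg_fderiv_mul_of_integrable`, one orthonormal direction at
  a time; no boundary terms);
* `sphereIntegral_radial_mul` — radial weights factor out of sphere integrals.

## References

* L. C. Evans, R. F. Gariepy, *Measure theory and fine properties of functions* (1992), §5.8.
* L. Hörmander, *The analysis of linear partial differential operators I* (1983), Thm. 1.2.5
  (fundamental lemma of the calculus of variations).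
-/

noncomputable section

open Set Function Metric Module Filter MeasureTheory MeasureTheory.Measure
open scoped Topology RealInnerProductSpace ContDiff

namespace Literature.Analysis.FluidPDE

/-! ### One-dimensional preliminaries -/

/-- A product `φ · A` with `φ` continuous and supported inside an open set `U` on which `A` is
continuous is continuous everywhere (it vanishes near every point outside `U`). [folklore] -/
theorem continuous_mul_of_tsupport_subset_open {X : Type*} [TopologicalSpace X] {φ A : X → ℝ}
    {U : Set X} (hU : IsOpen U) (hφ : Continuous φ) (hsupp : tsupport φ ⊆ U)
    (hA : ContinuousOn A U) : Continuous fun r ↦ φ r * A r := by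
  refine continuous_iff_continuousAt.2 fun r ↦ ?_
  by_cases hr : r ∈ U
  · exact hφ.continuousAt.mul (hA.continuousAt (hU.mem_nhds hr))
  · have h0 : φ =ᶠ[𝓝 r] 0 := notMem_tsupport_iff_eventuallyEq.1 fun h ↦ hr (hsupp h)
    have h1 : (fun r ↦ φ r * A r) =ᶠ[𝓝 r] fun _ ↦ 0 := by
      filter_upwards [h0] with s hs
      simp [hs]
    exact (continuousAt_const.congr_of_eventuallyEq h1 :)

/-- **Du Bois-Reymond's lemma for `C¹` functions on `(0, ∞)`.** If `A` has the continuous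
derivative `A'` and `B` is continuous on `(0, ∞)`, and `∫ φ B = -∫ φ' A` for every smooth `φ`
compactly supported in `(0, ∞)`, then `A' = B` on `(0, ∞)` (integrate by parts and apply the
fundamental lemma of the calculus of variations). [folklore] -/
theorem eqOn_deriv_of_integral_mul_eq {A A' B : ℝ → ℝ} (hA : ∀ r, 0 < r → HasDerivAt A (A' r) r)
    (hA' : ContinuousOn A' (Ioi 0)) (hB : ContinuousOn B (Ioi 0))
    (h : ∀ φ : ℝ → ℝ, ContDiff ℝ ∞ φ → HasCompactSupport φ → tsupport φ ⊆ Ioi 0 →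
      ∫ r, φ r * B r = -∫ r, deriv φ r * A r) :
    EqOn A' B (Ioi 0) := by
  have hAc : ContinuousOn A (Ioi 0) := fun r hr ↦ (hA r hr).continuousAt.continuousWithinAt
  -- integration by parts on the line: `∫ φ' A = -∫ φ A'`
  have hibp : ∀ φ : ℝ → ℝ, ContDiff ℝ ∞ φ → HasCompactSupport φ → tsupport φ ⊆ Ioi 0 →
      ∫ r, deriv φ r * A r = -∫ r, φ r * A' r := by
    intro φ hφ hφc hφs
    have hφd : Differentiable ℝ φ := hφ.differentiable (by simp)
    have hdφc : HasCompactSupport (deriv φ) := hφc.deriv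
    have hdφs : tsupport (deriv φ) ⊆ Ioi 0 := tsupport_deriv_subset.trans hφs
    have hdA : ContinuousOn (fun r ↦ fderiv ℝ A r 1) (Ioi 0) :=
      hA'.congr fun r hr ↦ by rw [fderiv_apply_one_eq_deriv, (hA r hr).deriv]
    have e := integral_mul_fderiv_eq_neg_fderiv_mul_of_integrable (μ := (volume : Measure ℝ))
      (f := A) (g := φ) (v := 1) ?_ ?_ ?_ (fun r hr ↦ (hA r (hφs hr)).differentiableAt)
      (fun r _ ↦ hφd r)
    · have e1 : ∫ r, A r * fderiv ℝ φ r 1 = ∫ r, deriv φ r * A r :=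
        integral_congr_ae (ae_of_all _ fun r ↦ by
          dsimp only
          rw [fderiv_apply_one_eq_deriv, mul_comm])
      have e2 : ∫ r, fderiv ℝ A r 1 * φ r = ∫ r, φ r * A' r := by
        refine integral_congr_ae (ae_of_all _ fun r ↦ ?_)
        dsimp only
        by_cases hr : r ∈ tsupport φ
        · rw [fderiv_apply_one_eq_deriv, (hA r (hφs hr)).deriv, mul_comm]
        · simp [image_eq_zero_of_notMem_tsupport hr]
      rw [← e1, e, e2]
    · -- `A' φ` integrable
      have hc : Continuous fun r ↦ φ r * fderiv ℝ A r 1 :=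
        continuous_mul_of_tsupport_subset_open isOpen_Ioi hφ.continuous hφs hdA
      have hi : Integrable (fun r ↦ φ r * fderiv ℝ A r 1) (volume : Measure ℝ) :=
        hc.integrable_of_hasCompactSupport (hφc.mul_right (f' := fun r ↦ fderiv ℝ A r 1))
      exact hi.congr (ae_of_all _ fun r ↦ mul_comm _ _)
    · -- `A φ'` integrable
      have hc : Continuous fun r ↦ deriv φ r * A r :=
        continuous_mul_of_tsupport_subset_open isOpen_Ioi (hφ.continuous_deriv (by simp)) hdφs hAc
      have hi : Integrable (fun r ↦ deriv φ r * A r) (volume : Measure ℝ) :=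
        hc.integrable_of_hasCompactSupport (hdφc.mul_right (f' := A))
      exact hi.congr (ae_of_all _ fun r ↦ by simp [mul_comm])
    · -- `A φ` integrable
      have hc : Continuous fun r ↦ φ r * A r :=
        continuous_mul_of_tsupport_subset_open isOpen_Ioi hφ.continuous hφs hAc
      have hi : Integrable (fun r ↦ φ r * A r) (volume : Measure ℝ) :=
        hc.integrable_of_hasCompactSupport (hφc.mul_right (f' := A))
      exact hi.congr (ae_of_all _ fun r ↦ mul_comm _ _)
  -- the fundamental lemma of the calculus of variations on `(0, ∞)`
  have hloc : LocallyIntegrableOn (fun r ↦ B r - A' r) (Ioi 0) volume :=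
    (hB.sub hA').locallyIntegrableOn measurableSet_Ioi
  have hae := (isOpen_Ioi (a := (0 : ℝ))).ae_eq_zero_of_integral_contDiff_smul_eq_zero hloc
    fun φ hφ hφc hφs ↦ by
      have hc1 : Continuous fun r ↦ φ r * B r :=
        continuous_mul_of_tsupport_subset_open isOpen_Ioi hφ.continuous hφs hB
      have hc2 : Continuous fun r ↦ φ r * A' r :=
        continuous_mul_of_tsupport_subset_open isOpen_Ioi hφ.continuous hφs hA'
      have hi1 : Integrable (fun r ↦ φ r * B r) (volume : Measure ℝ) :=
        hc1.integrable_of_hasCompactSupport (hφc.mul_right (f' := B))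
      have hi2 : Integrable (fun r ↦ φ r * A' r) (volume : Measure ℝ) :=
        hc2.integrable_of_hasCompactSupport (hφc.mul_right (f' := A'))
      simp only [smul_eq_mul, mul_sub]
      rw [integral_sub hi1 hi2, h φ hφ hφc hφs, hibp φ hφ hφc hφs]
      ring
  have hae' : (fun r ↦ B r - A' r) =ᵐ[volume.restrict (Ioi 0)] fun _ ↦ (0 : ℝ) :=
    (ae_restrict_iff' measurableSet_Ioi).2 hae
  have heq := Measure.eqOn_open_of_ae_eq hae' isOpen_Ioi (hB.sub hA') continuousOn_const
  intro r hr
  have := heq hr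
  simp only at this
  linarith

/-! ### Radial weights and radial test functions -/

variable {E : Type*} [NormedAddCommGroup E] [InnerProductSpace ℝ E] [FiniteDimensional ℝ E]
  [MeasurableSpace E] [BorelSpace E] (μ : Measure E) [μ.IsAddHaarMeasure]

omit [FiniteDimensional ℝ E] [BorelSpace E] [μ.IsAddHaarMeasure] in
/-- A radial weight factors out of a sphere integral: `∫ φ(‖rα‖) g(rα) dσ = φ(r) ∫ g(rα) dσ` for
`r ≥ 0`. [folklore] -/
theorem sphereIntegral_radial_mul (φ : ℝ → ℝ) (g : E → ℝ) {r : ℝ} (hr : 0 ≤ r) :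
    sphereIntegral μ (fun x ↦ φ ‖x‖ * g x) r = φ r * sphereIntegral μ g r := by
  rw [sphereIntegral_def, sphereIntegral_def, ← integral_const_mul]
  refine integral_congr_ae (ae_of_all _ fun α ↦ ?_)
  simp only [norm_smul_sphere hr]

/-! ### Integration by parts against radial test functions -/

omit [FiniteDimensional ℝ E] [MeasurableSpace E] [BorelSpace E] in
/-- The derivative of the norm away from the origin: `D‖·‖(x) = ‖x‖⁻¹ ⟪x, ·⟫` (a private copy
of `Literature.Analysis.FluidPDE.hasFDerivAt_norm_of_ne_zero` of `DuchonRobertShellLaw`, not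
imported here to keep this file light). [folklore] -/
private theorem hasFDerivAt_norm' {x : E} (hx : x ≠ 0) :
    HasFDerivAt (fun y : E ↦ ‖y‖) (‖x‖⁻¹ • (innerSL ℝ x : E →L[ℝ] ℝ)) x := by
  have h1 : HasFDerivAt (fun y : E ↦ ‖y‖ ^ 2) (2 • (innerSL ℝ x : E →L[ℝ] ℝ)) x :=
    (hasStrictFDerivAt_norm_sq x).hasFDerivAt
  have hx2 : ‖x‖ ^ 2 ≠ 0 := by positivity
  have h3 : HasFDerivAt (fun y : E ↦ Real.sqrt (‖y‖ ^ 2))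
      ((1 / (2 * Real.sqrt (‖x‖ ^ 2))) • (2 • (innerSL ℝ x : E →L[ℝ] ℝ))) x :=
    (Real.hasDerivAt_sqrt hx2).comp_hasFDerivAt x h1
  simp only [Real.sqrt_sq_eq_abs, abs_norm] at h3
  refine h3.congr_fderiv ?_
  have hx' : ‖x‖ ≠ 0 := norm_ne_zero_iff.2 hx
  rw [← Nat.cast_smul_eq_nsmul ℝ, smul_smul]
  congr 1
  push_cast
  field_simp

omit [FiniteDimensional ℝ E] [MeasurableSpace E] [BorelSpace E] in
/-- A radial test function `ψ = φ ∘ ‖·‖` with `φ` smooth and supported in `(0, ∞)` is `C¹` with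
`Dψ(x) = (φ'(‖x‖) ‖x‖⁻¹) ⟪x, ·⟫` (and `ψ = 0` near the origin). [folklore] -/
theorem contDiff_comp_norm_of_tsupport_subset {φ : ℝ → ℝ} (hφ : ContDiff ℝ ∞ φ)
    (hφs : tsupport φ ⊆ Ioi 0) :
    ContDiff ℝ 1 (fun x : E ↦ φ ‖x‖) ∧
      ∀ x : E, fderiv ℝ (fun x : E ↦ φ ‖x‖) x = (deriv φ ‖x‖ * ‖x‖⁻¹) • (innerSL ℝ x : E →L[ℝ] ℝ) := by
  have h0 : φ =ᶠ[𝓝 0] 0 := notMem_tsupport_iff_eventuallyEq.1 fun h ↦ lt_irrefl _ (mem_Ioi.1 (hφs h))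
  have hψ0 : (fun x : E ↦ φ ‖x‖) =ᶠ[𝓝 0] fun _ ↦ 0 := by
    have := (tendsto_norm_zero (E := E)).eventually h0
    filter_upwards [this] with x hx
    exact hx
  have hdiff : ∀ x : E, x ≠ 0 → HasFDerivAt (fun x : E ↦ φ ‖x‖)
      ((deriv φ ‖x‖ * ‖x‖⁻¹) • (innerSL ℝ x : E →L[ℝ] ℝ)) x := fun x hx ↦ by
    have h := ((hφ.differentiable (by simp)) ‖x‖).hasDerivAt.comp_hasFDerivAt x
      (hasFDerivAt_norm' hx)
    rw [smul_smul] at h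
    exact h
  constructor
  · refine contDiff_iff_contDiffAt.2 fun x ↦ ?_
    by_cases hx : x = 0
    · subst hx
      exact (contDiffAt_const (c := (0 : ℝ))).congr_of_eventuallyEq hψ0
    · exact (hφ.of_le (by simp)).contDiffAt.comp x (contDiffAt_norm ℝ hx)
  · intro x
    by_cases hx : x = 0
    · subst hx
      rw [hψ0.fderiv_eq, fderiv_fun_const, Pi.zero_apply, norm_zero, h0.deriv_eq]
      simp
    · exact (hdiff x hx).fderiv

omit [MeasurableSpace E] [BorelSpace E] in
/-- The divergence `x ↦ tr DV(x)` of a `C¹` field is continuous (the trace is a linear, hence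
continuous, function of the derivative on the finite-dimensional space `E →L[ℝ] E`).
[folklore] -/
theorem continuous_trace_fderiv {V : E → E} (hV : ContDiff ℝ 1 V) :
    Continuous fun x ↦ LinearMap.trace ℝ E (fderiv ℝ V x : E →ₗ[ℝ] E) := by
  set L : (E →L[ℝ] E) →ₗ[ℝ] ℝ := (LinearMap.trace ℝ E).comp (ContinuousLinearMap.coeLM ℝ)
    with hL
  have hLc : Continuous L := L.continuous_of_finiteDimensional
  exact hLc.comp (hV.continuous_fderiv one_ne_zero)

omit [FiniteDimensional ℝ E] [MeasurableSpace E] [BorelSpace E] in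
/-- In an orthonormal basis `b`, `tr DV(x) = ∑ᵢ ⟪bᵢ, DV(x) bᵢ⟫ = ∑ᵢ ∂ᵢ ⟪bᵢ, V⟫ (x)`. [folklore] -/
theorem trace_fderiv_eq_sum {ι : Type*} [Fintype ι] (b : OrthonormalBasis ι ℝ E) {V : E → E}
    (hV : Differentiable ℝ V) (x : E) :
    LinearMap.trace ℝ E (fderiv ℝ V x : E →ₗ[ℝ] E) =
      ∑ i, fderiv ℝ (fun y ↦ ⟪b i, V y⟫) x (b i) := by
  rw [LinearMap.trace_eq_sum_inner _ b]
  refine Finset.sum_congr rfl fun i _ ↦ ?_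
  have h : HasFDerivAt (fun y ↦ ⟪b i, V y⟫) ((innerSL ℝ (b i) : E →L[ℝ] ℝ).comp (fderiv ℝ V x)) x :=
    (innerSL ℝ (b i) : E →L[ℝ] ℝ).hasFDerivAt.comp x (hV x).hasFDerivAt
  rw [h.fderiv]
  rfl

/-- **Integration by parts against a radial test function.** For `V ∈ C¹(E; E)` and `φ` smooth,
compactly supported in `(0, ∞)`:
`∫ φ(‖x‖) div V(x) dμ = −∫ φ'(‖x‖) ⟪‖x‖⁻¹ x, V x⟫ dμ` (`div V = tr DV`; no boundary terms since
`φ ∘ ‖·‖` has compact support; one coordinate direction of an orthonormal basis at a time via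
Mathlib's `integral_mul_fderiv_eq_neg_fderiv_mul_of_integrable`). [folklore] -/
theorem integral_radial_mul_divergence {V : E → E} (hV : ContDiff ℝ 1 V) {φ : ℝ → ℝ}
    (hφ : ContDiff ℝ ∞ φ) (hφc : HasCompactSupport φ) (hφs : tsupport φ ⊆ Ioi 0) :
    ∫ x, φ ‖x‖ * LinearMap.trace ℝ E (fderiv ℝ V x : E →ₗ[ℝ] E) ∂μ =
      -∫ x, deriv φ ‖x‖ * ⟪‖x‖⁻¹ • x, V x⟫ ∂μ := by
  obtain ⟨hψ, hDψ⟩ := contDiff_comp_norm_of_tsupport_subset (E := E) hφ hφs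
  -- compact support of `ψ = φ ∘ ‖·‖`
  obtain ⟨R, hR⟩ := hφc.isCompact.isBounded.subset_closedBall 0
  have hψ0 : ∀ x : E, x ∉ closedBall (0 : E) R → φ ‖x‖ = 0 := fun x hx ↦ by
    refine image_eq_zero_of_notMem_tsupport fun h ↦ ?_
    have := hR h
    rw [mem_closedBall, dist_zero_right, Real.norm_eq_abs, abs_norm] at this
    exact hx (mem_closedBall.2 (by simpa using this))
  have hψc : HasCompactSupport fun x : E ↦ φ ‖x‖ :=
    HasCompactSupport.intro (isCompact_closedBall 0 R) hψ0
  have hDψc : HasCompactSupport (fderiv ℝ fun x : E ↦ φ ‖x‖) := hψc.fderiv ℝ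
  have hψcont : Continuous fun x : E ↦ φ ‖x‖ := hψ.continuous
  have hDψcont : Continuous (fderiv ℝ fun x : E ↦ φ ‖x‖) := hψ.continuous_fderiv one_ne_zero
  have hVd : Differentiable ℝ V := hV.differentiable one_ne_zero
  have hDVc : Continuous (fderiv ℝ V) := hV.continuous_fderiv one_ne_zero
  -- an orthonormal basis and the component functions `gᵢ = ⟪bᵢ, V⟫`
  obtain ⟨b⟩ : Nonempty (OrthonormalBasis (Fin (finrank ℝ E)) ℝ E) := ⟨stdOrthonormalBasis ℝ E⟩
  have hgd : ∀ (i) (x : E), HasFDerivAt (fun y ↦ ⟪b i, V y⟫)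
      ((innerSL ℝ (b i) : E →L[ℝ] ℝ).comp (fderiv ℝ V x)) x :=
    fun i x ↦ (innerSL ℝ (b i) : E →L[ℝ] ℝ).hasFDerivAt.comp x (hVd x).hasFDerivAt
  have hDg : ∀ (i) (x v : E), fderiv ℝ (fun y ↦ ⟪b i, V y⟫) x v = ⟪b i, fderiv ℝ V x v⟫ :=
    fun i x v ↦ by
    rw [(hgd i x).fderiv]
    rfl
  have hgc : ∀ i, Continuous fun y ↦ ⟪b i, V y⟫ := fun i ↦ continuous_const.inner hV.continuous
  have hDgc : ∀ i, Continuous fun x ↦ fderiv ℝ (fun y ↦ ⟪b i, V y⟫) x (b i) := fun i ↦ by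
    have : (fun x ↦ fderiv ℝ (fun y ↦ ⟪b i, V y⟫) x (b i)) = fun x ↦ ⟪b i, fderiv ℝ V x (b i)⟫ :=
      funext fun x ↦ hDg i x (b i)
    rw [this]
    exact continuous_const.inner (hDVc.clm_apply continuous_const)
  -- integrability of the products
  have hI1 : ∀ i, Integrable (fun x ↦ φ ‖x‖ * fderiv ℝ (fun y ↦ ⟪b i, V y⟫) x (b i)) μ :=
    fun i ↦ (hψcont.mul (hDgc i)).integrable_of_hasCompactSupport
      (hψc.mul_right (f' := fun x ↦ fderiv ℝ (fun y ↦ ⟪b i, V y⟫) x (b i)))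
  have hI2 : ∀ i, Integrable (fun x ↦ fderiv ℝ (fun x : E ↦ φ ‖x‖) x (b i) * ⟪b i, V x⟫) μ :=
    fun i ↦ ((hDψcont.clm_apply continuous_const).mul (hgc i)).integrable_of_hasCompactSupport
      ((hψc.fderiv_apply ℝ (b i)).mul_right (f' := fun x ↦ ⟪b i, V x⟫))
  have hI3 : ∀ i, Integrable (fun x ↦ φ ‖x‖ * ⟪b i, V x⟫) μ :=
    fun i ↦ (hψcont.mul (hgc i)).integrable_of_hasCompactSupport
      (hψc.mul_right (f' := fun x ↦ ⟪b i, V x⟫))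
  -- integration by parts in each direction
  have hibp : ∀ i, ∫ x, φ ‖x‖ * fderiv ℝ (fun y ↦ ⟪b i, V y⟫) x (b i) ∂μ =
      -∫ x, fderiv ℝ (fun x : E ↦ φ ‖x‖) x (b i) * ⟪b i, V x⟫ ∂μ := fun i ↦
    integral_mul_fderiv_eq_neg_fderiv_mul_of_integrable (hI2 i) (hI1 i) (hI3 i)
      (fun x _ ↦ hψ.differentiable one_ne_zero x) (fun x _ ↦ (hgd i x).differentiableAt)
  -- left-hand side as a sum over the basis
  have hL : ∫ x, φ ‖x‖ * LinearMap.trace ℝ E (fderiv ℝ V x : E →ₗ[ℝ] E) ∂μ =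
      ∑ i, ∫ x, φ ‖x‖ * fderiv ℝ (fun y ↦ ⟪b i, V y⟫) x (b i) ∂μ := by
    have : (fun x ↦ φ ‖x‖ * LinearMap.trace ℝ E (fderiv ℝ V x : E →ₗ[ℝ] E)) =
        fun x ↦ ∑ i, φ ‖x‖ * fderiv ℝ (fun y ↦ ⟪b i, V y⟫) x (b i) := by
      funext x
      rw [trace_fderiv_eq_sum b hVd, Finset.mul_sum]
    rw [this, integral_finsetSum _ fun i _ ↦ hI1 i]
  -- right-hand side as a sum over the basis
  have hR : ∫ x, deriv φ ‖x‖ * ⟪‖x‖⁻¹ • x, V x⟫ ∂μ =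
      ∑ i, ∫ x, fderiv ℝ (fun x : E ↦ φ ‖x‖) x (b i) * ⟪b i, V x⟫ ∂μ := by
    have : (fun x : E ↦ deriv φ ‖x‖ * ⟪‖x‖⁻¹ • x, V x⟫) =
        fun x ↦ ∑ i, fderiv ℝ (fun x : E ↦ φ ‖x‖) x (b i) * ⟪b i, V x⟫ := by
      funext x
      have hsum : ∑ i, fderiv ℝ (fun x : E ↦ φ ‖x‖) x (b i) * ⟪b i, V x⟫ =
          fderiv ℝ (fun x : E ↦ φ ‖x‖) x (V x) := by
        conv_rhs => rw [← b.sum_repr' (V x)]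
        rw [_root_.map_sum]
        refine Finset.sum_congr rfl fun i _ ↦ ?_
        rw [map_smul, smul_eq_mul, mul_comm]
      rw [hsum, hDψ x, _root_.smul_apply, innerSL_apply_apply, smul_eq_mul,
        real_inner_smul_left, mul_assoc]
    rw [this, integral_finsetSum _ fun i _ ↦ hI2 i]
  rw [hL, hR, Finset.sum_congr rfl fun i _ ↦ hibp i, Finset.sum_neg_distrib]

end Literature.Analysis.FluidPDE

end
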